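import Summits.HodgeConjecture.HodgeConjecture.Theorems.F0P2oThetaTypeOwnClass
import Literature.NumberTheory.Automorphic.Liu2021.LemD1SplitPlaceOfFacts
import Literature.NumberTheory.Automorphic.Liu2021.LemD1IsotropyOfPlace
import Literature.NumberTheory.Automorphic.Liu2021.SplitPlaceOscillatorModelProofs
import Literature.NumberTheory.Automorphic.Zelevinsky1980.UnitaryCharacterInductionIrreducible
import Literature.RepresentationTheory.MoeglinVignerasWaldspurger1987.RankOneThetaLiftIrreducibleProofs
import Literature.RepresentationTheory.MoeglinVignerasWaldspurger1987.RankOneThetaLiftAdmissibleProofs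
import Literature.RepresentationTheory.MoeglinVignerasWaldspurger1987.RankOneThetaLiftNonvanishingProofs
import Literature.NumberTheory.GelbartRogawski1991.UndoubledSplittingsUnitary
import Literature.NumberTheory.GelbartRogawski1991.CMSplittingCharLocalMu
import Literature.NumberTheory.GelbartRogawski1991.LocalLineModelTransport
import HarnessLib

/-!
# Crux `H413`, programme P2, line `F0_P2GR91NJacquet` (#76 U′-N local pay-down) — K1c «OWN CLASS»: Liu's local theta type
# `X_v(μ, ε, χ_f)` is IRREDUCIBLE and SMOOTH at every finite place, and the head `thetaTypeAtCM_self`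

Cell hodgecm-mathlib (D-0151), FLOOR 0, crux item H413 = stmt-HodgeConjecture-24833, programme P2, socket 27455; pay-down line
`Cruxes/H413/Lines/F0_P2GR91NJacquet.lean` (03185efdbb79 ∕ v1.1), stub K1 `stub_thetaType_in_principalSeries : StubThetaInPS`
(lead B-p18 (g27), K1 LEAD PLAN v0 `F0/P2/B-p18/K1-PLAN.v0.B-p18g27.md` §1).  THIS FILE = K1c (i) + the head (second hand F0P2-p05 (g0));
the model-free plumbing K1c (ii)(iii) is ★ `Theorems/F0P2oThetaTypeOwnClass.lean`.  THEOREMS ONLY (no `def`, no instance, no notation,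
no named fact, no `sorry`); kernel lane `--supports stmt-HodgeConjecture-24833 --as helper`.  HC_CM is proved only modulo the 2 remaining
named inputs (hLiu418, h413) until rung 0 closes; this file discharges none of them.

* §1 `X_v(μ,ε,χ_f)` = ★ `xThetaCM … ε v` is IRREDUCIBLE and SMOOTH at EVERY finite place `v` (split or not) for every CONTINUOUS UNITARY `χ_f`
  — [Liu2021, Lem. D.1, first sentence + non-vanishing] in the tree's model, UNCONDITIONALLY (`xTheta_local_triple`: non-split `v` by [MVW87,
  Chap. 3 IV.4 1a) 2a), IV.2] ★ + isotropy of rank 3 ★; split `v` by the `GL₃` model ★ + [Zelevinsky1980 Thm 4.2] ★ under the unitarity of `ω_v` ★;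
  then «irreducible-or-zero ∧ non-zero ⇒ irreducible» and the pull-back along the onto, continuous `k ↦ k ⊗ 1`);
* §2 `πG := X_v ∘ κ_v⁻¹ ∘ ((cmDatumLocalCongr v T).trans (localPiEquiv v)⁻¹)` on `Gqs L v` (the registered K1 sub-line's spelling) is irreducible
  and smooth (`isIrreducible_xThetaGqs` ∕ `isSmooth_xThetaGqs` = K1b's `hirr` ∕ `hπ` BY NAME) and the HEAD `thetaTypeAtCM_self`:
  `ThetaTypeAtCM L H e₁ dV hdV hdV0 g hg μ hμ χf ε v (IrrClass.comap (cmDatumLocalCongr L v T ha h).symm ⟦πG⟧)`, ANY finite `v`;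
* §3 **`stubK1c_holds`** — the registered stub `stub_K1c : StubK1cOwnClass` of `Cruxes/H413/Lines/F0_P2GR91NJacquetK1.lean` (58d7bd08daa5) with its
  body as type, token for token (fold `stub_K1c := F0P2oXThetaOwnClass.stubK1c_holds`).

## References
* [Liu2021] Y. Liu, Camb. J. Math. 9 (2021) = arXiv:2102.11518: Def. 4.11 (l. 2090–2096), App. D Lem. D.1 (l. 5226–5229), proof l. 5249–5266.
* [MoeglinVignerasWaldspurger1987] C. Mœglin, M.-F. Vignéras, J.-L. Waldspurger, LNM 1291 (1987), Chap. 3 IV.2, IV.4 Thm principal 1a) 2a).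
* [Zelevinsky1980] Ann. Sci. ÉNS 13 (1980), Thm 4.2.  [GelbartRogawski1991] Invent. Math. 105 (1991), §3.1 Prop. 3.1.1, §5.1, Lem. 5.1.2 p. 466.
* [BushnellHenniart2006] C. Bushnell, G. Henniart, Grundlehren 335, §1.1, §2.  [PlatonovRapinchuk1994] §2.3.  [GelbartRogawski1990] §2.6.
-/

set_option autoImplicit false
set_option linter.dupNamespace false -- the mandated namespace repeats the single-problem summit's segment

noncomputable section

open NumberField IsDedekindDomain MeasureTheory
open scoped Matrix Kronecker

namespace Summit.HodgeConjecture.HodgeConjecture.Cruxes.H413.F0P2oXThetaOwnClass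

open Literature.NumberTheory Literature.NumberTheory.Automorphic Literature.NumberTheory.Automorphic.UnitaryGroup
open Literature.NumberTheory.Automorphic.IdeleClassGroup
open Literature.NumberTheory.Automorphic.Liu2021 Literature.NumberTheory.Automorphic.Liu2021.Def411WeilCarriers
open Literature.NumberTheory.Automorphic.Liu2021.Def411WeilCarriersDoubling
open Literature.NumberTheory.GelbartRogawski1991 Literature.NumberTheory.GelbartRogawski1991.UnitaryDualPair
open Literature.NumberTheory.GelbartRogawski1991.UnitaryDualPair.WeilCoinv
open Literature.NumberTheory.GelbartRogawski1991.GRConstruction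
open Literature.NumberTheory.GelbartRogawski1991.UnitaryDualPair.LocalSplitting
open Literature.RepresentationTheory Literature.RepresentationTheory.Liu2021
open Literature.RepresentationTheory.MoeglinVignerasWaldspurger1987
open Literature.NumberTheory.GaloisRepresentations Literature.NumberTheory.Rogawski1990

/-! ## §1 Liu's local theta type `X_v(μ, ε, χ_f)` is irreducible and smooth at every finite place -/

section Local

variable (L : Type) [Field L] [NumberField L] [IsCMField L] {n' : ℕ} (e₁ : Fin 3 × Fin 1 ≃ Fin n') (dV : Fin 3 → L)
    (hdV : ∀ i, IsCMField.complexConj L (dV i) = dV i) (hdV0 : ∀ i, dV i ≠ 0)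
    (μ : Literature.NumberTheory.Automorphic.IdeleClassGroup L →ₜ* Circle) (hμ : IsConjugateSymplectic L μ)
    (χf : UnitaryGroup.finAdelicOne (↥(maximalRealSubfield L)) L (IsCMField.complexConj L) →* ℂˣ)
    (hcont : Continuous χf) (hunit : ∀ z, ‖((χf z : ℂˣ) : ℂ)‖ = 1) (ε : (↥(maximalRealSubfield L))ˣ)
    (v : HeightOneSpectrum (𝓞 ↥(maximalRealSubfield L)))

omit [IsCMField L] in
/-- `3 ≤ n'` from the line frame `Fin 3 × Fin 1 ≃ Fin n'`. [folklore] -/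
theorem three_le (e₁ : Fin 3 × Fin 1 ≃ Fin n') : 3 ≤ n' := by
  have h := Fintype.card_congr e₁
  simp only [Fintype.card_prod, Fintype.card_fin, mul_one] at h
  omega

include hcont hunit in
set_option synthInstance.maxHeartbeats 400000 in
set_option maxHeartbeats 16000000 in
/-- **[Liu2021, Lem. D.1, first sentence + non-vanishing] in the tree's model, at EVERY finite place `v`, UNCONDITIONALLY**: the
`χ_{f,v}`-coinvariant quotient of the local Weil representation `ω_v = (chiLocalSplittingsCM … μ … ε).omegaLoc v` of
`U(diag dV ⊗ (ε))(L⁺_v)` along its centre `U((ε))(L⁺_v) = E¹_v` (the term of which ★ `xThetaCM … ε v` is the pull-back along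
`k ↦ k ⊗ 1`) is IRREDUCIBLE-OR-ZERO, ADMISSIBLE and NON-ZERO.  Non-split `v`: [MVW87 Chap. 3 IV.4 1a) 2a), IV.2] ★ at the section
`𝓢.s v`, the rank-3 space being isotropic (★ `isIsotropic_localLemD1Data`); split `v`: the `GL₃`-model ★
`splitPlace_model_consequences_of_facts` (★ `splitPlace_chiCoinv_iso_parabolicIndGL_of_isIrreducible`, [Zelevinsky1980 Thm 4.2] ★) under
the unitarity ★ `isL2Isometric_omegaLoc_congrW_undoubledSplittings_cmFinLocalFamily` of `ω_v`.
[cite: Liu2021, App. D Lemma D.1 (l. 5227–5229), proof l. 5249–5266] [cite: MoeglinVignerasWaldspurger1987, Chap. 3 IV.4 Thm principal 1a), 2a); IV.2]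
[cite: Zelevinsky1980, Thm. 4.2] [cite: GelbartRogawski1991, §3.1 Prop. 3.1.1 p. 455] -/
theorem xTheta_local_triple :
    IsIrreducibleOrZero (TwistedCoinv.rep
        (ρW := show Representation ℂ (localPi L (IsCMField.complexConj L) 1 (JW (↥(maximalRealSubfield L)) L ε) v)
            (SchwartzBruhat (Fin n' → v.adicCompletion ↥(maximalRealSubfield L))) from
          ((chiLocalSplittingsCM L e₁ dV hdV hdV0 (toHeckeCharacter L μ) ((isOscillatorChar_toHeckeCharacter_iff μ).mpr hμ) ε).omegaLoc v).comp
            (localCenter L (IsCMField.complexConj L) n' (Matrix.reindex e₁ e₁ (Matrix.diagonal dV ⊗ₖ JW (↥(maximalRealSubfield L)) L ε))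
              (JW (↥(maximalRealSubfield L)) L ε) (JW_apply_ne_zero (↥(maximalRealSubfield L)) L ε) v))
        (localCharOfCenter (↥(maximalRealSubfield L)) L (IsCMField.complexConj L) (JW (↥(maximalRealSubfield L)) L ε)
          (JW_apply_ne_zero (↥(maximalRealSubfield L)) L ε) χf v)
        ((chiLocalSplittingsCM L e₁ dV hdV hdV0 (toHeckeCharacter L μ) ((isOscillatorChar_toHeckeCharacter_iff μ).mpr hμ) ε).omegaLoc v)
        (commute_omegaLoc_localCenter (↥(maximalRealSubfield L)) L (IsCMField.complexConj L) 3 e₁ (Matrix.diagonal dV)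
          (JW (↥(maximalRealSubfield L)) L ε) (complexConj_imagUnit L) (imagUnit_ne_zero L) (imagUnit_mul_self L)
          (realDiagonal_isSymm L dV hdV) (isSymm_TW (↥(maximalRealSubfield L)) ε) (realDiagonal_map L dV hdV).symm
          (JW_eq (↥(maximalRealSubfield L)) L ε) (JW_apply_ne_zero (↥(maximalRealSubfield L)) L ε)
          (chiLocalSplittingsCM L e₁ dV hdV hdV0 (toHeckeCharacter L μ) ((isOscillatorChar_toHeckeCharacter_iff μ).mpr hμ) ε) v)) ∧
    (TwistedCoinv.rep
        (ρW := show Representation ℂ (localPi L (IsCMField.complexConj L) 1 (JW (↥(maximalRealSubfield L)) L ε) v)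
            (SchwartzBruhat (Fin n' → v.adicCompletion ↥(maximalRealSubfield L))) from
          ((chiLocalSplittingsCM L e₁ dV hdV hdV0 (toHeckeCharacter L μ) ((isOscillatorChar_toHeckeCharacter_iff μ).mpr hμ) ε).omegaLoc v).comp
            (localCenter L (IsCMField.complexConj L) n' (Matrix.reindex e₁ e₁ (Matrix.diagonal dV ⊗ₖ JW (↥(maximalRealSubfield L)) L ε))
              (JW (↥(maximalRealSubfield L)) L ε) (JW_apply_ne_zero (↥(maximalRealSubfield L)) L ε) v))
        (localCharOfCenter (↥(maximalRealSubfield L)) L (IsCMField.complexConj L) (JW (↥(maximalRealSubfield L)) L ε)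
          (JW_apply_ne_zero (↥(maximalRealSubfield L)) L ε) χf v)
        ((chiLocalSplittingsCM L e₁ dV hdV hdV0 (toHeckeCharacter L μ) ((isOscillatorChar_toHeckeCharacter_iff μ).mpr hμ) ε).omegaLoc v)
        (commute_omegaLoc_localCenter (↥(maximalRealSubfield L)) L (IsCMField.complexConj L) 3 e₁ (Matrix.diagonal dV)
          (JW (↥(maximalRealSubfield L)) L ε) (complexConj_imagUnit L) (imagUnit_ne_zero L) (imagUnit_mul_self L)
          (realDiagonal_isSymm L dV hdV) (isSymm_TW (↥(maximalRealSubfield L)) ε) (realDiagonal_map L dV hdV).symm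
          (JW_eq (↥(maximalRealSubfield L)) L ε) (JW_apply_ne_zero (↥(maximalRealSubfield L)) L ε)
          (chiLocalSplittingsCM L e₁ dV hdV hdV0 (toHeckeCharacter L μ) ((isOscillatorChar_toHeckeCharacter_iff μ).mpr hμ) ε) v)).IsAdmissible ∧
    Nontrivial (TwistedCoinv.Coinv
        (show Representation ℂ (localPi L (IsCMField.complexConj L) 1 (JW (↥(maximalRealSubfield L)) L ε) v)
            (SchwartzBruhat (Fin n' → v.adicCompletion ↥(maximalRealSubfield L))) from
          ((chiLocalSplittingsCM L e₁ dV hdV hdV0 (toHeckeCharacter L μ) ((isOscillatorChar_toHeckeCharacter_iff μ).mpr hμ) ε).omegaLoc v).comp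
            (localCenter L (IsCMField.complexConj L) n' (Matrix.reindex e₁ e₁ (Matrix.diagonal dV ⊗ₖ JW (↥(maximalRealSubfield L)) L ε))
              (JW (↥(maximalRealSubfield L)) L ε) (JW_apply_ne_zero (↥(maximalRealSubfield L)) L ε) v))
        (localCharOfCenter (↥(maximalRealSubfield L)) L (IsCMField.complexConj L) (JW (↥(maximalRealSubfield L)) L ε)
          (JW_apply_ne_zero (↥(maximalRealSubfield L)) L ε) χf v)) := by
  -- Haar data of record at `v`
  letI : MeasurableSpace (v.adicCompletion ↥(maximalRealSubfield L)) := (borelPlaceMeasure L v).mS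
  haveI : BorelSpace (v.adicCompletion ↥(maximalRealSubfield L)) := (borelPlaceMeasure L v).isBorel
  haveI : (borelPlaceMeasure L v).μ.IsAddHaarMeasure := (borelPlaceMeasure L v).isHaar
  have hn : 3 ≤ n' := three_le e₁
  -- unitarity of the local Weil representation of the CM family
  have hL2 := isL2Isometric_omegaLoc_congrW_undoubledSplittings_cmFinLocalFamily L e₁ dV hdV hdV0
    (lineW L (TW (↥(maximalRealSubfield L)) ε)) (complexConj_lineW L (TW (↥(maximalRealSubfield L)) ε))
    (lineW_ne_zero L (TW (↥(maximalRealSubfield L)) ε) (isUnit_det_TW (↥(maximalRealSubfield L)) ε)) (toHeckeCharacter L μ)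
    ((isOscillatorChar_toHeckeCharacter_iff μ).mpr hμ) (borelPlaceMeasure L) v (isUnitary_toHeckeCharacter L μ)
    (realDiagonal_lineW L (TW (↥(maximalRealSubfield L)) ε))
    (diagonal_lineW L (TW (↥(maximalRealSubfield L)) ε) (JW_eq (↥(maximalRealSubfield L)) L ε))
    (isSymm_TW (↥(maximalRealSubfield L)) ε) (JW_eq (↥(maximalRealSubfield L)) L ε) (borelPlaceMeasure L v).μ
  by_cases hf : IsField (LocalRing L v)
  · -- NON-SPLIT: the three MVW facts at the section `𝓢.s v`; isotropy of the rank-3 space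
    have hiso : LemD1.IsIsotropic (LemD1OfPlace.standingData L v (IsCMField.complexConj L) n'
        (Matrix.reindex e₁ e₁ (Matrix.diagonal dV ⊗ₖ JW (↥(maximalRealSubfield L)) L ε)) (complexConj_imagUnit L) (imagUnit_ne_zero L)
        (Nat.le_of_succ_le hn)
        (reindex_kronecker_JW_hermitian (↥(maximalRealSubfield L)) L (IsCMField.complexConj L) 3 e₁ (Matrix.diagonal dV)
          (realDiagonal_isSymm L dV hdV) (realDiagonal_map L dV hdV).symm ε)
        (det_reindex_kronecker_JW_ne_zero (↥(maximalRealSubfield L)) L 3 e₁ (Matrix.diagonal dV)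
          (isUnit_det_realDiagonal L dV hdV hdV0) (realDiagonal_map L dV hdV).symm ε)) :=
      isIsotropic_localLemD1Data (↥(maximalRealSubfield L)) L (IsCMField.complexConj L) 3 e₁ (Matrix.diagonal dV)
        (complexConj_imagUnit L) (imagUnit_ne_zero L) (imagUnit_mul_self L) (realDiagonal_isSymm L dV hdV)
        (isUnit_det_realDiagonal L dV hdV hdV0) (realDiagonal_map L dV hdV).symm ε
        (chiLocalSplittingsCM L e₁ dV hdV hdV0 (toHeckeCharacter L μ) ((isOscillatorChar_toHeckeCharacter_iff μ).mpr hμ) ε) hn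
        (localMu L (toHeckeCharacter L μ))
        (fun v x => norm_localMu L (toHeckeCharacter L μ) v (isUnitary_toHeckeCharacter L μ) x)
        (continuous_localMu L (toHeckeCharacter L μ))
        (fun v t => localMu_toLocalRing_eq_one_iff L (toHeckeCharacter L μ) v ((isOscillatorChar_toHeckeCharacter_iff μ).mpr hμ) t)
        χf hunit hcont v
    exact ⟨mvw_IV4_rankOne_irreducibleOrZero_holds (↥(maximalRealSubfield L)) L (IsCMField.complexConj L) n' _
          (complexConj_imagUnit L) (imagUnit_ne_zero L) _ (imagUnit_mul_self L) _ _
          (isUnit_det_gram (↥(maximalRealSubfield L)) e₁ (isUnit_det_realDiagonal L dV hdV hdV0) (isUnit_det_TW (↥(maximalRealSubfield L)) ε))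
          _ _ v hf
          ((chiLocalSplittingsCM L e₁ dV hdV hdV0 (toHeckeCharacter L μ) ((isOscillatorChar_toHeckeCharacter_iff μ).mpr hμ) ε).s v)
          ((chiLocalSplittingsCM L e₁ dV hdV hdV0 (toHeckeCharacter L μ) ((isOscillatorChar_toHeckeCharacter_iff μ).mpr hμ) ε).proj_s v)
          ((chiLocalSplittingsCM L e₁ dV hdV hdV0 (toHeckeCharacter L μ) ((isOscillatorChar_toHeckeCharacter_iff μ).mpr hμ) ε).smooth v)
          (JW (↥(maximalRealSubfield L)) L ε) (JW_apply_ne_zero (↥(maximalRealSubfield L)) L ε) _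
          (norm_localCharOfCenter (↥(maximalRealSubfield L)) L (IsCMField.complexConj L) (JW (↥(maximalRealSubfield L)) L ε)
            (JW_apply_ne_zero (↥(maximalRealSubfield L)) L ε) hunit v)
          (continuous_coe_localCharOfCenter (↥(maximalRealSubfield L)) L (IsCMField.complexConj L) (JW (↥(maximalRealSubfield L)) L ε)
            (JW_apply_ne_zero (↥(maximalRealSubfield L)) L ε) hcont v),
      mvw_IV4_rankOne_admissible_holds (↥(maximalRealSubfield L)) L (IsCMField.complexConj L) n' _
          (complexConj_imagUnit L) (imagUnit_ne_zero L) _ (imagUnit_mul_self L) _ _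
          (isUnit_det_gram (↥(maximalRealSubfield L)) e₁ (isUnit_det_realDiagonal L dV hdV hdV0) (isUnit_det_TW (↥(maximalRealSubfield L)) ε))
          _ _ v hf
          ((chiLocalSplittingsCM L e₁ dV hdV hdV0 (toHeckeCharacter L μ) ((isOscillatorChar_toHeckeCharacter_iff μ).mpr hμ) ε).s v)
          ((chiLocalSplittingsCM L e₁ dV hdV hdV0 (toHeckeCharacter L μ) ((isOscillatorChar_toHeckeCharacter_iff μ).mpr hμ) ε).proj_s v)
          ((chiLocalSplittingsCM L e₁ dV hdV hdV0 (toHeckeCharacter L μ) ((isOscillatorChar_toHeckeCharacter_iff μ).mpr hμ) ε).smooth v)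
          (JW (↥(maximalRealSubfield L)) L ε) (JW_apply_ne_zero (↥(maximalRealSubfield L)) L ε) _
          (norm_localCharOfCenter (↥(maximalRealSubfield L)) L (IsCMField.complexConj L) (JW (↥(maximalRealSubfield L)) L ε)
            (JW_apply_ne_zero (↥(maximalRealSubfield L)) L ε) hunit v)
          (continuous_coe_localCharOfCenter (↥(maximalRealSubfield L)) L (IsCMField.complexConj L) (JW (↥(maximalRealSubfield L)) L ε)
            (JW_apply_ne_zero (↥(maximalRealSubfield L)) L ε) hcont v),
      mvw_IV2_rankOne_nonvanishing_of_isotropic_holds (↥(maximalRealSubfield L)) L (IsCMField.complexConj L) n' _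
          (complexConj_imagUnit L) (imagUnit_ne_zero L) _ (imagUnit_mul_self L) _ _
          (isUnit_det_gram (↥(maximalRealSubfield L)) e₁ (isUnit_det_realDiagonal L dV hdV hdV0) (isUnit_det_TW (↥(maximalRealSubfield L)) ε))
          _ _ v hf (Nat.le_of_succ_le hn)
          (reindex_kronecker_JW_hermitian (↥(maximalRealSubfield L)) L (IsCMField.complexConj L) 3 e₁ (Matrix.diagonal dV)
            (realDiagonal_isSymm L dV hdV) (realDiagonal_map L dV hdV).symm ε)
          (det_reindex_kronecker_JW_ne_zero (↥(maximalRealSubfield L)) L 3 e₁ (Matrix.diagonal dV)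
            (isUnit_det_realDiagonal L dV hdV hdV0) (realDiagonal_map L dV hdV).symm ε) hiso
          ((chiLocalSplittingsCM L e₁ dV hdV hdV0 (toHeckeCharacter L μ) ((isOscillatorChar_toHeckeCharacter_iff μ).mpr hμ) ε).s v)
          ((chiLocalSplittingsCM L e₁ dV hdV hdV0 (toHeckeCharacter L μ) ((isOscillatorChar_toHeckeCharacter_iff μ).mpr hμ) ε).proj_s v)
          ((chiLocalSplittingsCM L e₁ dV hdV hdV0 (toHeckeCharacter L μ) ((isOscillatorChar_toHeckeCharacter_iff μ).mpr hμ) ε).smooth v)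
          (JW (↥(maximalRealSubfield L)) L ε) (JW_apply_ne_zero (↥(maximalRealSubfield L)) L ε) _
          (norm_localCharOfCenter (↥(maximalRealSubfield L)) L (IsCMField.complexConj L) (JW (↥(maximalRealSubfield L)) L ε)
            (JW_apply_ne_zero (↥(maximalRealSubfield L)) L ε) hunit v)
          (continuous_coe_localCharOfCenter (↥(maximalRealSubfield L)) L (IsCMField.complexConj L) (JW (↥(maximalRealSubfield L)) L ε)
            (JW_apply_ne_zero (↥(maximalRealSubfield L)) L ε) hcont v)⟩
  · -- SPLIT: the `GL₃` model
    exact splitPlace_model_consequences_of_facts (↥(maximalRealSubfield L)) L (IsCMField.complexConj L) 3 e₁ (Matrix.diagonal dV)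
      (complexConj_imagUnit L) (imagUnit_ne_zero L) (imagUnit_mul_self L) (realDiagonal_isSymm L dV hdV)
      (isUnit_det_realDiagonal L dV hdV hdV0) (realDiagonal_map L dV hdV).symm ε
      (chiLocalSplittingsCM L e₁ dV hdV hdV0 (toHeckeCharacter L μ) ((isOscillatorChar_toHeckeCharacter_iff μ).mpr hμ) ε) hn
      χf hunit hcont v
      (splitPlace_chiCoinv_iso_parabolicIndGL_of_isIrreducible
        Zelevinsky1980.parabolicIndGL_detChar_unitary_isIrreducible_holds.{0})
      Zelevinsky1980.parabolicIndGL_detChar_unitary_isIrreducible_holds.{0} (borelPlaceMeasure L v).μ hf hL2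

include hcont hunit in
set_option synthInstance.maxHeartbeats 400000 in
set_option maxHeartbeats 16000000 in
/-- **K1c (i), irreducibility: Liu's local theta type `X_v(μ, ε, χ_f)` = ★ `xThetaCM … ε v` of `U(diag dV)(L⁺_v)` is IRREDUCIBLE at
every finite place `v`** (continuous unitary `χ_f`, conjugate-symplectic `μ`, any line `ε`): irreducible-or-zero and non-zero (`xTheta_local_triple`)
⇒ irreducible (★ `isIrreducible_of_nontrivial`), pulled back along the onto `k ↦ k ⊗ 1` (★ `localLineInl_surjective`,
★ `isIrreducible_comp_iff_of_surjective`). [cite: Liu2021, Def. 4.11 (l. 2090–2096); App. D Lemma D.1 (l. 5227–5229)]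
[cite: MoeglinVignerasWaldspurger1987, Chap. 3 IV.4 Thm principal 1a); IV.2] -/
theorem isIrreducible_xThetaCM : Representation.IsIrreducible (xThetaCM L e₁ dV hdV hdV0 μ hμ χf ε v) := by
  obtain ⟨h1, -, h3⟩ := xTheta_local_triple L e₁ dV hdV hdV0 μ hμ χf hcont hunit ε v
  haveI := h3
  have hirr := isIrreducible_of_nontrivial h1
  exact (Representation.isIrreducible_comp_iff_of_surjective _ _
    (localLineInl_surjective L (IsCMField.complexConj L) 3 e₁ (Matrix.diagonal dV) (JW (↥(maximalRealSubfield L)) L ε)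
      (JW_apply_ne_zero (↥(maximalRealSubfield L)) L ε) v)).2 hirr

include hcont hunit in
set_option synthInstance.maxHeartbeats 400000 in
set_option maxHeartbeats 16000000 in
/-- **K1c (i), smoothness: `X_v(μ, ε, χ_f)` = ★ `xThetaCM … ε v` is SMOOTH at every finite place `v`** (admissible quotient, `xTheta_local_triple`,
pulled back along the continuous `k ↦ k ⊗ 1`, ★ `continuous_localLineInl`, ★ `IsSmooth.comp`).
[cite: Liu2021, Def. 4.11 (l. 2096); App. D Lemma D.1 (l. 5227)] [cite: MoeglinVignerasWaldspurger1987, Chap. 3 IV.4 Thm principal 2a)] -/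
theorem isSmooth_xThetaCM : Representation.IsSmooth (xThetaCM L e₁ dV hdV hdV0 μ hμ χf ε v) := by
  obtain ⟨-, h2, -⟩ := xTheta_local_triple L e₁ dV hdV hdV0 μ hμ χf hcont hunit ε v
  exact h2.isSmooth.comp _ (continuous_localLineInl (↥(maximalRealSubfield L)) L (IsCMField.complexConj L) 3
    (Matrix.diagonal dV) v e₁ (JW (↥(maximalRealSubfield L)) L ε))

end Local

/-! ## §2 The K1b inputs by name, the HEAD, and the registered stub `stub_K1c` closed BY NAME -/

section Head

variable (L : Type) [Field L] [NumberField L] [IsCMField L] (H : Matrix (Fin 3) (Fin 3) L) {n' : ℕ} (e₁ : Fin 3 × Fin 1 ≃ Fin n')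
    (dV : Fin 3 → L) (hdV : ∀ i, IsCMField.complexConj L (dV i) = dV i) (hdV0 : ∀ i, dV i ≠ 0) (g : GL (Fin 3) L)
    (hg : ((g : Matrix (Fin 3) (Fin 3) L).map (cmConjRingHom L))ᵀ * H * (g : Matrix (Fin 3) (Fin 3) L) = Matrix.diagonal dV)
    (μ : Literature.NumberTheory.Automorphic.IdeleClassGroup L →ₜ* Circle) (hμ : IsConjugateSymplectic L μ)
    (χf : UnitaryGroup.finAdelicOne (↥(maximalRealSubfield L)) L (IsCMField.complexConj L) →* ℂˣ)
    (hcont : Continuous χf) (hunit : ∀ z, ‖((χf z : ℂˣ) : ℂ)‖ = 1) (ε : (↥(maximalRealSubfield L))ˣ)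
    (v : HeightOneSpectrum (𝓞 ↥(maximalRealSubfield L)))
    (T : GL (Fin 3) (UnitaryGroup.LocalRing L v)) (a : UnitaryGroup.LocalRing L v) (ha : IsUnit a)
    (h : formCongr (conjLocal L (IsCMField.complexConj L) v) T (H.map (algebraMap L (UnitaryGroup.LocalRing L v))) =
      a • (Matrix.of fun i j : Fin 3 => if i.val + j.val + 1 = 3 then (1 : L) else 0).map (algebraMap L (UnitaryGroup.LocalRing L v)))

include hg hcont hunit

set_option synthInstance.maxHeartbeats 400000 in
set_option maxHeartbeats 16000000 in
/-- **`πG := X_v(μ,ε,χ_f) ∘ κ_v⁻¹ ∘ ((cmDatumLocalCongr v T).trans (localPiEquiv v)⁻¹)` on `Gqs L v = U(Φ₃)(L⁺_v)` — the spelling of the registered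
K1 sub-line `Lines/F0_P2GR91NJacquetK1.lean` (58d7bd08daa5) — is IRREDUCIBLE** for continuous unitary `χ_f`, at every finite place (§1 + onto group
isomorphisms): the `hirr` of K1b's ★ `isConstituentOf_mk_cmPrincipalSeries_xi_of_functional`.
[cite: Liu2021, App. D Lemma D.1 (l. 5227)] [cite: MoeglinVignerasWaldspurger1987, Chap. 3 IV.4 Thm principal 1a); IV.2] [cite: PlatonovRapinchuk1994, §2.3] -/
theorem isIrreducible_xThetaGqs :
    Representation.IsIrreducible
      (((xThetaCM L e₁ dV hdV hdV0 μ hμ χf ε v :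
        localPi L (IsCMField.complexConj L) 3 (Matrix.diagonal dV) v →* _).comp
      (localCongr L (IsCMField.complexConj L) g one_ne_zero (by rw [one_smul]; exact hg) v).symm.toMulEquiv.toMonoidHom).comp
      ((cmDatumLocalCongr L v T ha h).trans (localPiEquiv L (IsCMField.complexConj L) 3 H v).symm).toMulEquiv.toMonoidHom) :=
  (F0P2oThetaTypeOwnClass.isIrreducible_piH L H e₁ dV hdV hdV0 g hg μ hμ χf ε v
    (isIrreducible_xThetaCM L e₁ dV hdV hdV0 μ hμ χf hcont hunit ε v)).comp_of_surjective _
    ((cmDatumLocalCongr L v T ha h).trans (localPiEquiv L (IsCMField.complexConj L) 3 H v).symm).surjective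

set_option synthInstance.maxHeartbeats 400000 in
set_option maxHeartbeats 16000000 in
/-- **`πG` is SMOOTH** for continuous unitary `χ_f`, at every finite place (§1 + continuous group isomorphisms): the `hπ` of K1b.
[cite: Liu2021, App. D Lemma D.1 (l. 5227)] [cite: MoeglinVignerasWaldspurger1987, Chap. 3 IV.4 Thm principal 2a)] [cite: PlatonovRapinchuk1994, §2.3] -/
theorem isSmooth_xThetaGqs :
    Representation.IsSmooth
      (((xThetaCM L e₁ dV hdV hdV0 μ hμ χf ε v :
        localPi L (IsCMField.complexConj L) 3 (Matrix.diagonal dV) v →* _).comp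
      (localCongr L (IsCMField.complexConj L) g one_ne_zero (by rw [one_smul]; exact hg) v).symm.toMulEquiv.toMonoidHom).comp
      ((cmDatumLocalCongr L v T ha h).trans (localPiEquiv L (IsCMField.complexConj L) 3 H v).symm).toMulEquiv.toMonoidHom) :=
  (F0P2oThetaTypeOwnClass.isSmooth_piH L H e₁ dV hdV hdV0 g hg μ hμ χf ε v
    (isSmooth_xThetaCM L e₁ dV hdV hdV0 μ hμ χf hcont hunit ε v)).comp _
    ((cmDatumLocalCongr L v T ha h).trans (localPiEquiv L (IsCMField.complexConj L) 3 H v).symm).continuous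

set_option synthInstance.maxHeartbeats 400000 in
set_option maxHeartbeats 16000000 in
/-- **READ-BACK** for this spelling: `⟦πG⟧` moved back along `(cmDatumLocalCongr v T)⁻¹` and read on `localPi … H v` through `localPiEquiv v` IS
`⟦X_v ∘ κ_v⁻¹⟧` (★ `IrrClass.comap_mk` is `rfl`; the identity of the space intertwines, `e (e⁻¹ x) = x`).
[cite: BushnellHenniart2006, §1.1] [cite: Rogawski1990, §12.2 p. 173] -/
theorem comap_comap_symm_mk_xThetaGqs :
    IrrClass.comap (localPiEquiv L (IsCMField.complexConj L) 3 H v)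
        (IrrClass.comap (cmDatumLocalCongr L v T ha h).symm
          (IrrClass.mk
            { V := _,
              ρ := (((xThetaCM L e₁ dV hdV hdV0 μ hμ χf ε v :
                    localPi L (IsCMField.complexConj L) 3 (Matrix.diagonal dV) v →* _).comp
                  (localCongr L (IsCMField.complexConj L) g one_ne_zero (by rw [one_smul]; exact hg) v).symm.toMulEquiv.toMonoidHom).comp
                  ((cmDatumLocalCongr L v T ha h).trans (localPiEquiv L (IsCMField.complexConj L) 3 H v).symm).toMulEquiv.toMonoidHom),
              isIrreducible := isIrreducible_xThetaGqs L H e₁ dV hdV hdV0 g hg μ hμ χf hcont hunit ε v T a ha h,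
              isSmooth := isSmooth_xThetaGqs L H e₁ dV hdV hdV0 g hg μ hμ χf hcont hunit ε v T a ha h })) =
      IrrClass.mk
        { V := _,
          ρ := ((xThetaCM L e₁ dV hdV hdV0 μ hμ χf ε v :
                localPi L (IsCMField.complexConj L) 3 (Matrix.diagonal dV) v →* _).comp
              (localCongr L (IsCMField.complexConj L) g one_ne_zero (by rw [one_smul]; exact hg) v).symm.toMulEquiv.toMonoidHom),
          isIrreducible := F0P2oThetaTypeOwnClass.isIrreducible_piH L H e₁ dV hdV hdV0 g hg μ hμ χf ε v
            (isIrreducible_xThetaCM L e₁ dV hdV hdV0 μ hμ χf hcont hunit ε v),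
          isSmooth := F0P2oThetaTypeOwnClass.isSmooth_piH L H e₁ dV hdV hdV0 g hg μ hμ χf ε v
            (isSmooth_xThetaCM L e₁ dV hdV hdV0 μ hμ χf hcont hunit ε v) } := by
  refine IrrClass.mk_eq_mk_of_equiv (Representation.Equiv.mk (LinearEquiv.refl ℂ _) fun g' => ?_)
  refine LinearMap.ext fun x => ?_
  -- `(congr_T.trans e_v⁻¹) (congr_T⁻¹ (e_v g')) = g'` (term-level: the two spellings `(cmDatum L 3 H).Local v` ∕ `↥(«local» …)` of `U(H)(L⁺_v)` defeat `rw`)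
  have hy : ((cmDatumLocalCongr L v T ha h).trans (localPiEquiv L (IsCMField.complexConj L) 3 H v).symm)
      ((cmDatumLocalCongr L v T ha h).symm ((localPiEquiv L (IsCMField.complexConj L) 3 H v) g')) = g' :=
    (congrArg (fun z => (localPiEquiv L (IsCMField.complexConj L) 3 H v).symm z)
      ((cmDatumLocalCongr L v T ha h).apply_symm_apply ((localPiEquiv L (IsCMField.complexConj L) 3 H v) g'))).trans
      ((localPiEquiv L (IsCMField.complexConj L) 3 H v).symm_apply_apply g')
  exact congrArg (fun y => (xThetaCM L e₁ dV hdV hdV0 μ hμ χf ε v)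
    ((localCongr L (IsCMField.complexConj L) g one_ne_zero (by rw [one_smul]; exact hg) v).symm y) x) hy

set_option synthInstance.maxHeartbeats 400000 in
set_option maxHeartbeats 16000000 in
/-- **HEAD `thetaTypeAtCM_self` — K1c «OWN CLASS» of line `F0_P2GR91NJacquet`.**  For a CM frame `ᵗ(c̄ g) H g = diag dV`, a conjugate-symplectic
`μ`, a CONTINUOUS UNITARY character `χ_f` of `U(1)(𝔸_{L⁺,f})`, any line `ε`, ANY finite place `v` of `L⁺` and any form congruence
`ᵗT̄ H_v T = a Φ₃`: the class `⟦πG⟧ ∈ Irr(U(Φ₃)(L⁺_v))` of Liu's local theta type `X_v(μ, ε, χ_f)` (★ `xThetaCM`, irreducible and smooth by §1)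
transported to `U(Φ₃)(L⁺_v)` (the registered sub-line's spelling of `πG`) satisfies
`ThetaTypeAtCM L H e₁ dV hdV hdV0 g hg μ hμ χf ε v (IrrClass.comap (cmDatumLocalCongr L v T ha h).symm ⟦πG⟧)` — a constituent of an IRREDUCIBLE `τ`
is `≃ τ`, and isotypic components only see the type up to `≃` (★ `F0P2iThetaTypeCriterion.isotypicComponent_eq_top_of_isConstituentOf_of_mk_eq`).
[cite: GelbartRogawski1991, §5.1 (5.1.1), Lem 5.1.2 p. 466] [cite: Liu2021, Def. 4.11 (l. 2090–2096); App. D Lemma D.1 (l. 5227)]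
[cite: MoeglinVignerasWaldspurger1987, Chap. 3 IV.4 Thm principal 1a) 2a); IV.2] [cite: BushnellHenniart2006, §1.1, §2] -/
theorem thetaTypeAtCM_self :
    ThetaTypeAtCM L H e₁ dV hdV hdV0 g hg μ hμ χf ε v
      (IrrClass.comap (cmDatumLocalCongr L v T ha h).symm
        (IrrClass.mk
          { V := _,
            ρ := (((xThetaCM L e₁ dV hdV hdV0 μ hμ χf ε v :
                  localPi L (IsCMField.complexConj L) 3 (Matrix.diagonal dV) v →* _).comp
                (localCongr L (IsCMField.complexConj L) g one_ne_zero (by rw [one_smul]; exact hg) v).symm.toMulEquiv.toMonoidHom).comp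
                ((cmDatumLocalCongr L v T ha h).trans (localPiEquiv L (IsCMField.complexConj L) 3 H v).symm).toMulEquiv.toMonoidHom),
            isIrreducible := isIrreducible_xThetaGqs L H e₁ dV hdV hdV0 g hg μ hμ χf hcont hunit ε v T a ha h,
            isSmooth := isSmooth_xThetaGqs L H e₁ dV hdV hdV0 g hg μ hμ χf hcont hunit ε v T a ha h })) := by
  intro T' _ _ τ hτ hc W' _ _ ρ' htop
  haveI := hτ
  exact F0P2iThetaTypeCriterion.isotypicComponent_eq_top_of_isConstituentOf_of_mk_eq
    (comap_comap_symm_mk_xThetaGqs L H e₁ dV hdV hdV0 g hg μ hμ χf hcont hunit ε v T a ha h).symm (Representation.Equiv.refl _)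
    hc ρ' htop

end Head

/-! ## §3 The registered stub `stub_K1c : StubK1cOwnClass` of `Cruxes/H413/Lines/F0_P2GR91NJacquetK1.lean`, CLOSED BY NAME -/

set_option synthInstance.maxHeartbeats 400000 in
set_option maxHeartbeats 16000000 in
/-- **`stubK1c_holds` — the registered stub `stub_K1c : StubK1cOwnClass` of the K1 sub-line `Cruxes/H413/Lines/F0_P2GR91NJacquetK1.lean`
(commit 58d7bd08daa5; B-p18 (g27) v2 ∕ desk F0P2-plan (g7)) CLOSED**: the type below is the BODY of `StubK1cOwnClass` token for token (the Lines module is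
not importable here), so the edition folds `theorem stub_K1c : StubK1cOwnClass := F0P2oXThetaOwnClass.stubK1c_holds`.  For EVERY line class `ε`
(and every finite `v` — the non-split hypothesis is not used): `πG` is irreducible (§2 `isIrreducible_xThetaGqs`) and smooth (`isSmooth_xThetaGqs`), and
`ThetaTypeAtCM … ε v` holds for its own class moved back along `(cmDatumLocalCongr v T)⁻¹` (`thetaTypeAtCM_self`).
[cite: Liu2021, App. D Lem. D.1 (1) (l. 5226–5229)] [cite: MoeglinVignerasWaldspurger1987, Chap. 3 IV.4 Thm principal 1a) 2a); IV.2]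
[cite: GelbartRogawski1991, §5.1 (5.1.1), Lem 5.1.2 p. 466] [cite: BourbakiAlgebreVIII2012, VIII §4 n°2] -/
theorem stubK1c_holds :
  ∀ (L : Type) [Field L] [NumberField L] [IsCMField L] (H : Matrix (Fin 3) (Fin 3) L) (hH : (H.map (cmConjRingHom L))ᵀ = H) (hHd : IsUnit H.det)
    {n' : ℕ} (e₁ : Fin 3 × Fin 1 ≃ Fin n') (dV : Fin 3 → L) (hdV : ∀ i, IsCMField.complexConj L (dV i) = dV i) (hdV0 : ∀ i, dV i ≠ 0) (g : GL (Fin 3) L)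
    (hg : ((g : Matrix (Fin 3) (Fin 3) L).map (cmConjRingHom L))ᵀ * H * (g : Matrix (Fin 3) (Fin 3) L) = Matrix.diagonal dV),
    ∀ (μ : Literature.NumberTheory.Automorphic.IdeleClassGroup L →ₜ* Circle) (hμ : IsConjugateSymplectic L μ)
      (χf : UnitaryGroup.finAdelicOne (↥(maximalRealSubfield L)) L (IsCMField.complexConj L) →* ℂˣ),
      Continuous χf → (∀ z, ‖((χf z : ℂˣ) : ℂ)‖ = 1) →
      ∀ (v : HeightOneSpectrum (𝓞 ↥(maximalRealSubfield L))),
        (∀ w : PlacesOver L v, IsCMField.complexConj L • w.1 = w.1) →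
        ∀ (T : GL (Fin 3) (UnitaryGroup.LocalRing L v)) (a : UnitaryGroup.LocalRing L v) (ha : IsUnit a)
          (h : formCongr (conjLocal L (IsCMField.complexConj L) v) T (H.map (algebraMap L (UnitaryGroup.LocalRing L v))) =
            a • (Matrix.of fun i j : Fin 3 => if i.val + j.val + 1 = 3 then (1 : L) else 0).map (algebraMap L (UnitaryGroup.LocalRing L v))),
          ∀ (ε : (↥(maximalRealSubfield L))ˣ),
            ∃ (hirr : Representation.IsIrreducible (((xThetaCM L e₁ dV hdV hdV0 μ hμ χf ε v :
              localPi L (IsCMField.complexConj L) 3 (Matrix.diagonal dV) v →* _).comp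
              (localCongr L (IsCMField.complexConj L) g one_ne_zero (by rw [one_smul]; exact hg) v).symm.toMulEquiv.toMonoidHom).comp
            ((cmDatumLocalCongr L v T ha h).trans (localPiEquiv L (IsCMField.complexConj L) 3 H v).symm).toMulEquiv.toMonoidHom))
              (hsm : Representation.IsSmooth (((xThetaCM L e₁ dV hdV hdV0 μ hμ χf ε v :
              localPi L (IsCMField.complexConj L) 3 (Matrix.diagonal dV) v →* _).comp
              (localCongr L (IsCMField.complexConj L) g one_ne_zero (by rw [one_smul]; exact hg) v).symm.toMulEquiv.toMonoidHom).comp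
            ((cmDatumLocalCongr L v T ha h).trans (localPiEquiv L (IsCMField.complexConj L) 3 H v).symm).toMulEquiv.toMonoidHom)),
              ThetaTypeAtCM L H e₁ dV hdV hdV0 g hg μ hμ χf ε v
                (IrrClass.comap (cmDatumLocalCongr L v T ha h).symm
                  (IrrClass.mk ⟨_, (((xThetaCM L e₁ dV hdV hdV0 μ hμ χf ε v :
              localPi L (IsCMField.complexConj L) 3 (Matrix.diagonal dV) v →* _).comp
              (localCongr L (IsCMField.complexConj L) g one_ne_zero (by rw [one_smul]; exact hg) v).symm.toMulEquiv.toMonoidHom).comp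
            ((cmDatumLocalCongr L v T ha h).trans (localPiEquiv L (IsCMField.complexConj L) 3 H v).symm).toMulEquiv.toMonoidHom), hirr, hsm⟩)) := by
  intro L _ _ _ H _ _ n' e₁ dV hdV hdV0 g hg μ hμ χf hcont hunit v _ T a ha h ε
  exact ⟨isIrreducible_xThetaGqs L H e₁ dV hdV hdV0 g hg μ hμ χf hcont hunit ε v T a ha h,
    isSmooth_xThetaGqs L H e₁ dV hdV hdV0 g hg μ hμ χf hcont hunit ε v T a ha h,
    thetaTypeAtCM_self L H e₁ dV hdV hdV0 g hg μ hμ χf hcont hunit ε v T a ha h⟩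

end Summit.HodgeConjecture.HodgeConjecture.Cruxes.H413.F0P2oXThetaOwnClass

end
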